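import Summits.AtomisticToContinuum.HydrodynamicLimit.Theorems.RelayRaceLocalityRestartPrincipleOfNoAnomalousDissipation
import HarnessLib

/-!
# Crux `RestartPrinciple` (stmt-AtomisticToContinuum-12503) — line `isentropic-regibbsification` (skeleton v8, lead c5)

Route `RelayRaceLocality`; crux decl
`Summit.AtomisticToContinuum.HydrodynamicLimit.Theses.RelayRaceLocality.RestartPrinciple` `= (S → G)` with `G → S`
landed (p101123), so the line proves the packing-guarded conjunct `G` (Disproof.lean §1–2; the antecedent `S`
is not consumable, p99454).

v8 = IMPORT FORM over landed modules. Everything the line needs except THE BET is a theorem in the tree: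

* `Theorems/RelayRaceLocalityRestartPrincipleOfNoAnomalousDissipation.lean` (lead c5):
  `restartPrinciple_of_noAnomalousDissipation : S4a → RestartPrinciple` — the whole composition (restart
  induction in ENTROPY currency with explicit LDA references `G_s = localGibbsLaw σ A_σ(ρ_s) u_s θ_s`; base case
  S1 `stub_profileIdentification` p116912 + S2 `stub_activityRelay` p117049 + bounded-LLN-means; step = entropy
  relay `stub_entropyRelay` p112983 + KL transport (`…LineGlue` p118862) + the Rényi step; final = LGC
  concentration + entropy inequality `tendstoHydroFieldsAt_of_klDiv`), UNCONDITIONAL: the shared statics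
  `JaynesSqueeze.HardSphereLDA` (13459) / `LocalGibbsConcentrationDilute` (13460) are closed in the tree
  (`hardSphereLDA_proof`, `localGibbsConcentrationDilute_proof`);
* the Rényi step is DERIVED: `renyiLocalEquilibriumLDA_of` (R2, p117955, lead c4) from S4a +
  `stub_kineticEnergyExpMoment` (S4b, p117016) + `stub_staticFlatness` (S4c, p117520) + `RenyiTransport`
  p114585 + `CgfFromLD` p114845 + `RenyiAlgebra` p117012 + `IsentropicCentring` p117509;
* partial results ON the bet (lead c5): its diagonal `t = s` is a theorem (`noAnomalousDissipation_static`,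
  `…StaticAnchor`), and the bet is EQUIVALENT, modulo closed statics, to the Rényi-`(1+γ)` short-time local
  equilibrium of the LDA gas (`noAnomalousDissipation_of_renyiLocalEquilibrium`, `…Tightness`, with R2).

So the skeleton is: ONE `sorry` (the registered stub `stub_noAnomalousDissipation`, S4a) and a one-line
composition `RestartPrinciple_of` concluding the crux BY NAME.
-/

noncomputable section

open Literature.MathematicalPhysics.KineticTheory Literature.Analysis.FluidPDE
open Literature.Analysis.FunctionSpaces MeasureTheory Filter Set Topology
open Summit.AtomisticToContinuum.HydrodynamicLimit.Theses.RelayRaceLocality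
open scoped ENNReal

namespace Summit.AtomisticToContinuum.HydrodynamicLimit.Cruxes.RestartPrinciple.IsentropicRegibbsification

/-- STUB S4a (XL; THE BET of the line, registered `stub_noAnomalousDissipation`). **No anomalous dissipation at
speed `N`** for the FRESH LDA local Gibbs gas: restarted at `s` with the exact LDA data `(A_σ(ρ_s), u_s, θ_s)` of a
classical hs-Euler solution and run to `t < s + τ₁(M)` under the route's guards on `[s, t]`, the log-likelihood
pairing of the evolved configuration against the time-`t` LDA reference profile does not DROP below its Euler
value `b̄_t = ∫ρ_t(log A_σ(ρ_t) − 3/2 log(2πθ_t) − 3/2)` by `δ` except with probability `≤ C e^{-(N+1)/C}`.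
Prefix `∃ η₀ ∃ σ₀ ∀ σ ∀ M ∃ τ₁ ∀ …` (σ₀ before `M`, restart from every `s`: the trap of p99454 is typed away).
TRUE on the diagonal `t = s` (`noAnomalousDissipation_static`); EQUIVALENT mod closed statics to the Rényi
short-time local equilibrium of the LDA gas (R2 + `noAnomalousDissipation_of_renyiLocalEquilibrium`); false
for free streaming (phase mixing), so any proof must use hard-sphere mixing at speed `N` — hydrodynamic-limit-hard.
[Yau1991 §1; OllaVaradhanYau1993 §3; BodineauGallagherSaintRaymondSimonella2023 (speed-N LD, Boltzmann–Grad only)] -/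
theorem stub_noAnomalousDissipation :
    ∃ η₀ : ℝ, 0 < η₀ ∧ ∃ σ₀ : ℝ, 0 < σ₀ ∧ ∀ σ : ℝ, 0 < σ → σ < σ₀ → ∀ M : ℝ, 0 < M →
        ∃ τ₁ : ℝ, 0 < τ₁ ∧ ∀ (T : ℝ) (ρ θ : ℝ → T3 → ℝ) (u : ℝ → T3 → V3),
        IsHardSphereEulerSolution σ T ρ u θ → (∀ s' ∈ Set.Ico 0 T, ∫ x, ρ s' x = 1) →
        ∀ Φ : (N : ℕ) → HardSphereFlow (Torus.geometry (Fin 3)) (hsDiameter σ N) (N + 1),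
        ∀ s ∈ Set.Ico 0 T, ∀ t ∈ Set.Ico s (min T (s + τ₁)),
        (∀ s' ∈ Set.Icc s t, ∀ x, ρ s' x * σ ^ 3 < η₀ ∧ ρ s' x ≤ M ∧ θ s' x ≤ M ∧ M⁻¹ ≤ θ s' x ∧
        ‖u s' x‖ ≤ M ∧ ∀ i j k : Fin 3, |Torus.partialDeriv i (ρ s') x| ≤ M ∧
        ‖Torus.partialDeriv i (u s') x‖ ≤ M ∧ |Torus.partialDeriv i (θ s') x| ≤ M ∧
        |Torus.partialDeriv i (Torus.partialDeriv j (ρ s')) x| ≤ M ∧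
        ‖Torus.partialDeriv i (Torus.partialDeriv j (u s')) x‖ ≤ M ∧
        |Torus.partialDeriv i (Torus.partialDeriv j (θ s')) x| ≤ M ∧
        |Torus.partialDeriv i (Torus.partialDeriv j (Torus.partialDeriv k (ρ s'))) x| ≤ M ∧
        ‖Torus.partialDeriv i (Torus.partialDeriv j (Torus.partialDeriv k (u s'))) x‖ ≤ M ∧
        |Torus.partialDeriv i (Torus.partialDeriv j (Torus.partialDeriv k (θ s'))) x| ≤ M) →
        ∀ δ : ℝ, 0 < δ → ∃ C : ℝ, 0 < C ∧ ∀ N : ℕ,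
        localGibbsLaw σ (fun x => ρ s x * Real.exp (hsExcessFreeEnergy (ρ s x * σ ^ 3) +
        ρ s x * σ ^ 3 * deriv hsExcessFreeEnergy (ρ s x * σ ^ 3))) (u s) (θ s) N (Φ N)
        {z | ((N : ℝ) + 1)⁻¹ * ∑ i, Real.log (localGibbsProfile
        (fun x => ρ t x * Real.exp (hsExcessFreeEnergy (ρ t x * σ ^ 3) +
        ρ t x * σ ^ 3 * deriv hsExcessFreeEnergy (ρ t x * σ ^ 3))) (u t) (θ t)
        ((Φ N).flow (t - s) z i)) <
        (∫ x, ρ t x * (Real.log (ρ t x * Real.exp (hsExcessFreeEnergy (ρ t x * σ ^ 3) +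
        ρ t x * σ ^ 3 * deriv hsExcessFreeEnergy (ρ t x * σ ^ 3))) -
        3 / 2 * Real.log (2 * Real.pi * θ t x) - 3 / 2)) - δ} ≤
        ENNReal.ofReal (C * Real.exp (-(C⁻¹ * (N + 1)))) := by
  sorry

/-- COMPOSITION: the crux `RestartPrinciple` BY NAME, from the single registered stub through the landed
composition `restartPrinciple_of_noAnomalousDissipation` (conditional on NOTHING else: 13459/13460 closed). -/
theorem RestartPrinciple_of : RestartPrinciple :=
  Theorems.RestartPrinciple.IsentropicRegibbsification.restartPrinciple_of_noAnomalousDissipation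
    stub_noAnomalousDissipation

end Summit.AtomisticToContinuum.HydrodynamicLimit.Cruxes.RestartPrinciple.IsentropicRegibbsification

end
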